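import Summits.Ventures.LatticeQCDFlow.Scaling.HubListsSharpLaw
import Summits.Ventures.LatticeQCDFlow.Scaling.UniversalPoincare

/-!
HONEST FRAMING: exact (Metropolis-corrected) sampling algorithms for lattice gauge theory; figures
of merit are autocorrelation/cost numbers at stated couplings and volumes; no continuum-physics
claim.

# GraphSchemeUniversalCeiling — EVERY CONNECTED EXCHANGE TOPOLOGY FORGETS A COLD START IN POLYNOMIALLY MANY STEPS:
# **`t_mix(1/4) ≤ ⌈U·log(4hU)⌉`, `U = max{2(K+1)K²m/t, 2(K+1)/h}`**, FOR THE HOMOGENEOUS SCHEME `t·ptGraphSwap ν^{⊗} e 1 + (1−t)·prodKernel w M` ON ANY CONNECTED LIST OF `m` PAIRS OVER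
# `K+1` LEVELS (`h = (1−t)w_0`); AND THE UNIVERSAL FLOOR UNIT `(K+1)/h ≤ 1/ρ` (lean-2 GEN-48, ours)

Venture-side (OURS).  Cell `lqcd-flow` (pub-lqcd), unit `pub-lqcd-lean-2-g48`, 2026-08-31.  Chapter AI (the sizes of the Robin ground state), file 8 — parents AI5 `HubListsSharpLaw` (AI4's sharp
law, `ceilLog_mono`) and AI7 `UniversalPoincare`.  AI4: on every connected list the ground state `(c, ρ)` gives `t_mix(1/4) ≤ ⌈(1/ρ)·log(4h/ρ)⌉`; AI7: `min{t/(2(K+1)K²m), h/(2(K+1))} ≤ ρ`.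
Hence the ceiling in the data `(K, m, t, h)` alone (§1), monotone in `1/ρ ≤ U`.  What is NOT claimed: sharpness — the universal unit `2(K+1)K²m/t` is the path's `K³/t` times `2(K+1)m/K`
(crude congestion); the dedicated files give the sharp units (path `K³`, star `K`, complete `K²`).  No definitions.

* `inv_le_max_of_min_le`, **`graphScheme_universal_ceiling`**, `graphScheme_universal_window`.

Reading (no numerics implied): whatever connected pattern of always-accepted swaps links `K+1` exchangeable replicas to one exactly refreshed seat, the configuration law is within `¼` of
`ν^{⊗(K+1)}` after `O(max{K³m/t, K/h}·log(Kmh/t))` steps; no connected topology is slower than polynomial, none is faster than the refresh budget `(K+1)/h` (AI1).  Literature grade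
(cell rule): OWN; nothing cited; no new bib keys.
-/

noncomputable section

open Finset Function Real
open Literature.Probability.MarkovChains

namespace Summit.Ventures.LatticeQCDFlow.Scaling

variable {S : Type*} [Fintype S] [DecidableEq S] {K m : ℕ} (e : Fin m → Fin (K + 1) × Fin (K + 1)) {ν : S → ℝ} {M : Fin (K + 1) → S → S → ℝ} {w : Fin (K + 1) → ℝ} {t : ℝ}
  {P : (Fin (K + 1) → S) → (Fin (K + 1) → S) → ℝ}

omit [Fintype S] [DecidableEq S] in
/-- `min{a, b} ≤ ρ` with `a, b > 0` ⇒ `1/ρ ≤ max{1/a, 1/b}`. [ours] -/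
theorem inv_le_max_of_min_le {a b ρ : ℝ} (ha : 0 < a) (hb : 0 < b) (hmin : min a b ≤ ρ) : 1 / ρ ≤ max (1 / a) (1 / b) := by
  rcases le_total a b with hab | hab
  · rw [min_eq_left hab] at hmin
    exact le_trans (one_div_le_one_div_of_le ha hmin) (le_max_left _ _)
  · rw [min_eq_right hab] at hmin
    exact le_trans (one_div_le_one_div_of_le hb hmin) (le_max_right _ _)

/-- **THE UNIVERSAL CEILING:** `m ≥ 1`, `K ≥ 1`, distinct endpoints, every non-empty proper set of levels crossed by a listed pair, `0 < t < 1`, `w` a probability vector with `w_0 > 0`,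
one positive law `ν`, exact hot sampler, idle cold kernels, `h = (1−t)w_0`; then with `U = max{2(K+1)K²m/t, 2(K+1)/h}`:
**`t_mix(1/4) ≤ ⌈U·log(4h·U)⌉`**. [ours] -/
theorem graphScheme_universal_ceiling (hm : 1 ≤ m) (hK : 1 ≤ K) (he : ∀ r, (e r).1 ≠ (e r).2)
    (hconn : ∀ A : Finset (Fin (K + 1)), A.Nonempty → A ≠ univ → ∃ r : Fin m, ((e r).1 ∈ A ∧ (e r).2 ∉ A) ∨ ((e r).2 ∈ A ∧ (e r).1 ∉ A))
    (hν : ∀ v, 0 < ν v) (hν1 : ∑ v, ν v = 1) (hM0 : ∀ u v, M 0 u v = ν v) (hidle : ∀ i : Fin K, ∀ u v, M i.succ u v = if v = u then 1 else 0)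
    (hw0 : ∀ k, 0 ≤ w k) (hw00 : 0 < w 0) (hw1 : ∑ k, w k = 1) (ht0 : 0 < t) (ht1 : t < 1)
    (hP : ∀ x y, P x y = t * ptGraphSwap (fun _ : Fin (K + 1) => ν) e (fun _ => Equiv.refl S) x y + (1 - t) * prodKernel w M x y) :
    mixingTime P (tensorFun (fun _ : Fin (K + 1) => ν)) (1 / 4)
      ≤ ⌈max (1 / (t / (2 * ((K : ℝ) + 1) * (K : ℝ) ^ 2 * m))) (1 / ((1 - t) * w 0 / (2 * ((K : ℝ) + 1))))
          * Real.log (4 * ((1 - t) * w 0) * max (1 / (t / (2 * ((K : ℝ) + 1) * (K : ℝ) ^ 2 * m))) (1 / ((1 - t) * w 0 / (2 * ((K : ℝ) + 1)))))⌉₊ := by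
  classical
  have hKpos : (0 : ℝ) < K := Nat.cast_pos.mpr (by omega)
  have hmpos : (0 : ℝ) < m := Nat.cast_pos.mpr (by omega)
  have hhh : 0 < (1 - t) * w 0 := mul_pos (by linarith) hw00
  obtain ⟨u⟩ : Nonempty S := by
    by_contra hS
    rw [not_nonempty_iff] at hS
    have : ∑ v : S, ν v = 0 := by rw [univ_eq_empty, sum_empty]
    rw [hν1] at this; exact one_ne_zero this
  obtain ⟨ρ, c, hρ0, hρle, hcpos, _, _, hvertex, _, hceil⟩ :=
    graphScheme_sharp_two_sided_exists e hm he hconn hν hν1 hM0 hidle hw0 hw00 hw1 ht0 ht1 hP u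
  have hwin := connected_rho_ge e (h := (1 - t) * w 0) hm hK ht0 hhh hconn hcpos hvertex
  have hU := inv_le_max_of_min_le (by positivity) (by positivity) hwin.1
  refine le_trans hceil ?_
  have h1 : 1 / ρ * Real.log (4 * ((1 - t) * w 0) / ρ) = 1 / ρ * Real.log (4 * ((1 - t) * w 0) * (1 / ρ)) := by rw [mul_one_div]
  rw [h1]
  refine ceilLog_mono (by positivity) hU ?_
  -- `1 ≤ 4h/ρ`
  have : ρ ≤ (1 - t) * w 0 := le_trans hρle (div_le_self hhh.le (by linarith))
  rw [mul_one_div, le_div_iff₀ hρ0]; linarith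

/-- **THE UNIVERSAL WINDOW, PACKAGED:** under the same hypotheses there are `ρ` and `c > 0` (the ground state, `Σc² = 1`) with
`min{t/(2(K+1)K²m), h/(2(K+1))} ≤ ρ ≤ h/(K+1)`, `c_k ≤ (1 + K·mh/t)·c_0` for all `k`, and for every content `u`
`((1−ρ)/ρ)·log((1−ν(u))Σ_kc_k/4) ≤ t_mix(1/4) ≤ ⌈(1/ρ)·log(4h/ρ)⌉`. [ours] -/
theorem graphScheme_universal_window (hm : 1 ≤ m) (hK : 1 ≤ K) (he : ∀ r, (e r).1 ≠ (e r).2)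
    (hconn : ∀ A : Finset (Fin (K + 1)), A.Nonempty → A ≠ univ → ∃ r : Fin m, ((e r).1 ∈ A ∧ (e r).2 ∉ A) ∨ ((e r).2 ∈ A ∧ (e r).1 ∉ A))
    (hν : ∀ v, 0 < ν v) (hν1 : ∑ v, ν v = 1) (hM0 : ∀ u v, M 0 u v = ν v) (hidle : ∀ i : Fin K, ∀ u v, M i.succ u v = if v = u then 1 else 0)
    (hw0 : ∀ k, 0 ≤ w k) (hw00 : 0 < w 0) (hw1 : ∑ k, w k = 1) (ht0 : 0 < t) (ht1 : t < 1)
    (hP : ∀ x y, P x y = t * ptGraphSwap (fun _ : Fin (K + 1) => ν) e (fun _ => Equiv.refl S) x y + (1 - t) * prodKernel w M x y) (u : S) :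
    ∃ (ρ : ℝ) (c : Fin (K + 1) → ℝ), 0 < ρ ∧ (∀ k, 0 < c k) ∧ ∑ k : Fin (K + 1), c k ^ 2 = 1 ∧
      min (t / (2 * ((K : ℝ) + 1) * (K : ℝ) ^ 2 * m)) ((1 - t) * w 0 / (2 * ((K : ℝ) + 1))) ≤ ρ ∧ ρ * ((K : ℝ) + 1) ≤ (1 - t) * w 0 ∧
      (∀ k, c k ≤ (1 + (K : ℝ) * (m * ((1 - t) * w 0) / t)) * c 0) ∧
      (1 - ρ) / ρ * Real.log ((1 - ν u) * (∑ k : Fin (K + 1), c k) / 4) ≤ (mixingTime P (tensorFun (fun _ : Fin (K + 1) => ν)) (1 / 4) : ℝ) ∧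
      mixingTime P (tensorFun (fun _ : Fin (K + 1) => ν)) (1 / 4) ≤ ⌈1 / ρ * Real.log (4 * ((1 - t) * w 0) / ρ)⌉₊ := by
  have hhh : 0 < (1 - t) * w 0 := mul_pos (by linarith) hw00
  obtain ⟨ρ, c, hρ0, _, hcpos, hcS, _, hvertex, hfloor, hceil⟩ :=
    graphScheme_sharp_two_sided_exists e hm he hconn hν hν1 hM0 hidle hw0 hw00 hw1 ht0 ht1 hP u
  have hwin := connected_rho_ge e (h := (1 - t) * w 0) hm hK ht0 hhh hconn hcpos hvertex
  have hshape := connected_le_hot_mul e (h := (1 - t) * w 0) hm ht0 hρ0 hconn hcpos hvertex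
  exact ⟨ρ, c, hρ0, hcpos, hcS, hwin.1, hwin.2, hshape, hfloor, hceil⟩

end Summit.Ventures.LatticeQCDFlow.Scaling

end
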